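import Literature.AlgebraicGeometry.Motives.GrassmannianChartLocus
import Mathlib.RingTheory.Flat.FaithfullyFlat.Algebra
import HarnessLib

/-!
# The standard chart: cokernel criterion and reflection of membership along faithfully flat / field maps

Topic `Literature/AlgebraicGeometry/Motives`; namespace `Literature.AlgebraicGeometry.Motives`, prefix `Grassmannian.`.  Sequel to
`GrassmannianChartLocus` ((C3)-instantiation); cell hodgecm-mathlib key (h4) (author B-p21 (g15), partner B-p18 (g17)), input for the
(A3) step «pointwise open conditions» of B-p09 (g12) (membership in the chart is read at residue fields and must be REFLECTED along
field extensions).  THEOREMS ONLY.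

With `C_x(N) := ((A ⊗ M)⧸N) ⧸ range (frameMap x N)` the cokernel of the frame map:

* `Grassmannian.mem_chart_iff_subsingleton_coker`, `Grassmannian.mem_chart_iff_annihilator_coker_eq_top` — `N ∈ chart x A ⟺ C_x(N) = 0
  ⟺ Ann_A C_x(N) = A` ((C2′) restated);
* **`Grassmannian.map_mem_chart_iff_of_faithfullyFlat`** — along a FAITHFULLY FLAT `f : A → B`, `map f N ∈ chart x B ⟺ N ∈ chart x A`
  (`Ann·B = B ⟹ Ann = A` by `I·B ∩ A = I`, Mathlib `Ideal.comap_map_eq_self_of_faithfullyFlat`);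
* **`Grassmannian.map_mem_chart_iff_of_field`** — along any map `f : K → L` from a FIELD to a non-zero ring (e.g. a field extension of
  residue fields), `map f N ∈ chart x L ⟺ N ∈ chart x K`;
* `Grassmannian.map_residueField_mem_chart_iff` — pointwise form of ★ `setOf_map_residueField_mem_chart_eq`.

[Stacks 089T] (the `U_I` are open subfunctors; membership is a pointwise condition); EGA I 9.7.4.
HC_CM is proved only modulo the 7 printed citations until rung 0 closes; nothing here is about HC.

## References
* [StacksProject, Tag 089T]; A. Grothendieck, EGA I (Springer 1971), §9.7.4; [EisenbudHarris2016, §3.2.2].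
-/

set_option autoImplicit false

noncomputable section

universe u v w

open TensorProduct PrimeSpectrum

namespace Literature.AlgebraicGeometry.Motives

namespace Grassmannian

variable {R : Type u} [CommRing R] {M : Type v} [AddCommGroup M] [Module R M] {k : ℕ}
variable {A : Type w} [CommRing A] [Algebra R A] {B : Type w} [CommRing B] [Algebra R B]

/-! ## §1 The cokernel criterion -/

/-- **`N ∈ chart x A ⟺` the cokernel of the frame map vanishes.** [cite: StacksProject, Tag 089T] -/
theorem mem_chart_iff_subsingleton_coker (x : Fin k → M) (N : Module.Grassmannian A (A ⊗[R] M) k) :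
    N ∈ chart R M k x A ↔
      Subsingleton (((A ⊗[R] M) ⧸ N.toSubmodule) ⧸ LinearMap.range (frameMap x N.toSubmodule)) := by
  rw [mem_chart_iff_surjective, ← LinearMap.range_eq_top, Submodule.Quotient.subsingleton_iff]

/-- **`N ∈ chart x A ⟺ Ann_A(coker frameMap x N) = A`.** [cite: StacksProject, Tag 089T] -/
theorem mem_chart_iff_annihilator_coker_eq_top (x : Fin k → M) (N : Module.Grassmannian A (A ⊗[R] M) k) :
    N ∈ chart R M k x A ↔
      Module.annihilator A (((A ⊗[R] M) ⧸ N.toSubmodule) ⧸ LinearMap.range (frameMap x N.toSubmodule)) = ⊤ := by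
  rw [mem_chart_iff_subsingleton_coker, Module.annihilator_eq_top_iff]

/-! ## §2 Reflection of chart membership -/

/-- **Chart membership is reflected along faithfully flat maps**: if `B` is a faithfully flat `A`-algebra (`f` the structure map),
then `map f N ∈ chart x B ⟺ N ∈ chart x A` (`⟸` is ★ `map_mem_chart` for any `f`). [cite: StacksProject, Tag 089T] -/
theorem map_mem_chart_iff_of_faithfullyFlat [Algebra A B] [IsScalarTower R A B] [Module.FaithfullyFlat A B]
    (x : Fin k → M) (N : Module.Grassmannian A (A ⊗[R] M) k) :
    Module.Grassmannian.map (IsScalarTower.toAlgHom R A B) N ∈ chart R M k x B ↔ N ∈ chart R M k x A := by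
  rw [map_mem_chart_iff_map_annihilator_eq_top, mem_chart_iff_annihilator_coker_eq_top, IsScalarTower.coe_toAlgHom]
  refine ⟨fun h => ?_, fun h => by rw [h, Ideal.map_top]⟩
  rw [← Ideal.comap_map_eq_self_of_faithfullyFlat (B := B)
    (Module.annihilator A (((A ⊗[R] M) ⧸ N.toSubmodule) ⧸ LinearMap.range (frameMap x N.toSubmodule))), h, Ideal.comap_top]

/-- **Chart membership is reflected along maps out of a field**: for `f : K → L` with `K` a field and `L ≠ 0` (e.g. an extension of
residue fields), `map f N ∈ chart x L ⟺ N ∈ chart x K`. [cite: StacksProject, Tag 089T] -/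
theorem map_mem_chart_iff_of_field {K : Type w} [Field K] [Algebra R K] {L : Type w} [CommRing L] [Nontrivial L] [Algebra R L]
    (f : K →ₐ[R] L) (x : Fin k → M) (N : Module.Grassmannian K (K ⊗[R] M) k) :
    Module.Grassmannian.map f N ∈ chart R M k x L ↔ N ∈ chart R M k x K := by
  rw [map_mem_chart_iff_map_annihilator_eq_top, mem_chart_iff_annihilator_coker_eq_top]
  rcases Ideal.eq_bot_or_top
      (Module.annihilator K (((K ⊗[R] M) ⧸ N.toSubmodule) ⧸ LinearMap.range (frameMap x N.toSubmodule))) with h | h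
  · rw [h, Ideal.map_bot]
    simp only [bot_ne_top]
  · rw [h, Ideal.map_top]
    exact iff_of_true rfl rfl

/-- **Pointwise form of the chart locus**: `N ⊗ κ(𝔭) ∈ chart x κ(𝔭) ⟺ 𝔭 ∉ Supp_A(coker frameMap x N)`. [cite: StacksProject, Tag 089T] -/
theorem map_residueField_mem_chart_iff (x : Fin k → M) (N : Module.Grassmannian A (A ⊗[R] M) k) (p : PrimeSpectrum A) :
    Module.Grassmannian.map (IsScalarTower.toAlgHom R A p.asIdeal.ResidueField) N ∈ chart R M k x p.asIdeal.ResidueField ↔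
      p ∉ Module.support A (((A ⊗[R] M) ⧸ N.toSubmodule) ⧸ LinearMap.range (frameMap x N.toSubmodule)) := by
  have h := Set.ext_iff.1 (setOf_map_residueField_mem_chart_eq (R := R) x N) p
  rwa [Set.mem_setOf_eq, Set.mem_compl_iff] at h

end Grassmannian

end Literature.AlgebraicGeometry.Motives

end
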